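import Mathlib.Analysis.SpecialFunctions.Pow.Continuity
import Mathlib.Analysis.SpecialFunctions.Sqrt
import Mathlib.Analysis.InnerProductSpace.Calculus
import Literature.Barriers.AtomisticToContinuum.ShockFormation
import HarnessLib

/-!
# Sideris 1985, Theorem 1 — pointwise algebra of the local energy method for the polytropic
# Euler system (sound speed, symmetrised energy density, flux domination)

Support file 1 for the discharge of
`Literature.Barriers.AtomisticToContinuum.ShockFormationBarrier` (Sideris, Comm. Math. Phys.
101 (1985), Thm. 1). The finite propagation speed "Proposition" of Sideris §1 ("a consequence of
local energy estimates", p. 476) is proved in the sibling files by the classical local energy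
method for the symmetrised system in the variables `(p, u, S)`:
`(γp)⁻¹ (∂ₜp + u·∇p) + div u = 0`, `ρ (∂ₜu + (u·∇)u) + ∇p = 0`, `∂ₜS + u·∇S = 0`.
This file contains the state-space (pointwise, derivative-free) ingredients:

* `soundSpeed A γ ρ S = (γ p / ρ)^{1/2}` (`p = A ρ^γ e^S`), the local sound speed; at the far
  field it is Sideris' `σ` (`farFieldSoundSpeed_eq_soundSpeed`, (1.3));
* `energyDensity A γ ρ̄ S̄ ρ u S = (p - p̄)²/(γ p) + ρ ‖u‖² + (S - S̄)²`, the quadratic energy of the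
  symmetrised system relative to the rest state `(ρ̄, 0, S̄)` (`p̄ = A ρ̄^γ e^{S̄}`), and the flux
  multiplier `energyFluxFactor = energyDensity + 2 (p - p̄)` (the energy flux is
  `energyFluxFactor • u`);
* `energyDensity_nonneg`, `eq_of_energyDensity_eq_zero` (the energy vanishes only at the rest
  state), and the **flux domination** inequality `energyFlux_domination`:
  `0 ≤ σ' e + ⟪ξ, u⟫ (e + 2 (p - p̄))` whenever `‖ξ‖ ≤ 1` and `‖u‖ + c ≤ σ'` — the positivity of
  the boundary form `σ' A⁰ - ξ·A` of a symmetric hyperbolic system on a space-like cone of speed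
  `σ'` (Sideris 1984, Proposition; Courant–Friedrichs; John);
* the `C¹` ramp `rampSq` and the backward-cone weight `coneWeight`, the weighted `coneEnergy`,
  Sideris' averaged quantities `massExcess`, `entropyMassExcess`, `radialMomentum` (1.4 a–c),
  and the named fact `FinitePropagationSpeed` (Sideris' Proposition, p. 476; discharged in the
  sibling files).

All declarations of the support suite live in the grouping sub-namespace
`Literature.Barriers.AtomisticToContinuum.PolytropicEuler` (the model), so that the generic
names (`soundSpeed`, `energyDensity`, …) do not occupy the directory namespace shared by the
other barrier files.

## Mathlib search

Mathlib has `Real.sqrt`, `Real.rpow` calculus and the Cauchy–Schwarz inequality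
`real_inner_le_norm`, `abs_real_inner_le_norm`; no compressible-Euler notions (searched
`Euler`, `polytropic`, `sound`: none outside this tree's `ShockFormation`).

## References

* T. C. Sideris, *Formation of singularities in three-dimensional compressible fluids*, Comm.
  Math. Phys. 101 (1985) 475–485, §1 (1.1)–(1.3), Proposition p. 476.
* T. C. Sideris, *Formation of singularities of solutions to nonlinear hyperbolic equations*,
  Arch. Rational Mech. Anal. 86 (1984) 369–381 (the Proposition: local energy estimates).
* F. John, *Partial Differential Equations*, 4th ed. (1982), Ch. 2 §5, Ch. 5 §3 (domain of
  dependence for symmetric hyperbolic systems by the energy method).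
-/

noncomputable section

open Set
open scoped RealInnerProductSpace

namespace Literature.Barriers.AtomisticToContinuum.PolytropicEuler

/-! ### The local sound speed -/

/-- The local sound speed `c(ρ, S) = (∂p/∂ρ)^{1/2} = (γ p / ρ)^{1/2}` of the polytropic gas
`p = A ρ^γ e^S` (Sideris (1.3) at a general state; Courant–Friedrichs). [cite: Sideris1985, (1.3)] -/
def soundSpeed (A γ ρ S : ℝ) : ℝ :=
  Real.sqrt (γ * polytropicPressure A γ ρ S / ρ)

/-- The sound speed is nonnegative (a square root). [cite: Sideris1985, (1.3)] -/
theorem soundSpeed_nonneg (A γ ρ S : ℝ) : 0 ≤ soundSpeed A γ ρ S :=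
  Real.sqrt_nonneg _

/-- `c² = γ p / ρ` at states with `A, γ, ρ > 0`. [cite: Sideris1985, (1.3)] -/
theorem soundSpeed_sq {A γ ρ S : ℝ} (hA : 0 < A) (hγ : 0 < γ) (hρ : 0 < ρ) :
    soundSpeed A γ ρ S ^ 2 = γ * polytropicPressure A γ ρ S / ρ :=
  Real.sq_sqrt (div_nonneg (mul_nonneg hγ.le (polytropicPressure_pos hA hρ).le) hρ.le)

/-- The sound speed is positive at states with `A, γ, ρ > 0`. [cite: Sideris1985, (1.3)] -/
theorem soundSpeed_pos {A γ ρ S : ℝ} (hA : 0 < A) (hγ : 0 < γ) (hρ : 0 < ρ) :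
    0 < soundSpeed A γ ρ S :=
  Real.sqrt_pos.2 (div_pos (mul_pos hγ (polytropicPressure_pos hA hρ)) hρ)

/-- Sideris' far-field speed `σ = (A γ ρ̄^{γ-1} e^{S̄})^{1/2}` is the sound speed of the rest state
`(ρ̄, S̄)` (Sideris (1.3): `σ = p_ρ(ρ̄, S̄)^{1/2}`). [cite: Sideris1985, (1.3)] -/
theorem farFieldSoundSpeed_eq_soundSpeed {A γ ρbar Sbar : ℝ} (hρ : 0 < ρbar) :
    farFieldSoundSpeed A γ ρbar Sbar = soundSpeed A γ ρbar Sbar := by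
  unfold farFieldSoundSpeed soundSpeed polytropicPressure
  congr 1
  rw [Real.rpow_sub_one hρ.ne']
  field_simp

/-- The sound speed is continuous in the state on `{ρ > 0}` (jointly in `(ρ, S)`). [folklore] -/
theorem continuousOn_soundSpeed (A γ : ℝ) :
    ContinuousOn (fun q : ℝ × ℝ => soundSpeed A γ q.1 q.2) ({r | 0 < r} ×ˢ univ) := by
  unfold soundSpeed polytropicPressure
  refine Real.continuous_sqrt.comp_continuousOn ?_
  refine ContinuousOn.div ?_ continuousOn_fst fun q hq => (ne_of_gt (mem_prod.1 hq).1)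
  refine continuousOn_const.mul ((continuousOn_const.mul ?_).mul
    (Real.continuous_exp.comp_continuousOn continuousOn_snd))
  exact continuousOn_fst.rpow_const fun q hq => Or.inl (ne_of_gt (mem_prod.1 hq).1)

/-! ### The symmetrised energy density relative to the rest state -/

/-- **Energy density of the symmetrised polytropic Euler system relative to the rest state
`(ρ̄, 0, S̄)`**: `e = (p - p̄)² / (γ p) + ρ ‖u‖² + (S - S̄)²`, `p = A ρ^γ e^S`, `p̄ = A ρ̄^γ e^{S̄}`
— the quadratic form `Vᵀ A⁰(U) V` of the symmetriser `A⁰ = diag((γp)⁻¹, ρ I₃, 1)` of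
(1.1 a–d) in the variables `(p, u, S)`, at `V = (p - p̄, u, S - S̄)` (Sideris 1984/1985, proof of
the Proposition by local energy estimates; Kato 1975 for the symmetric form). [folklore] -/
def energyDensity (A γ ρbar Sbar ρ : ℝ) (u : E3) (S : ℝ) : ℝ :=
  (polytropicPressure A γ ρ S - polytropicPressure A γ ρbar Sbar) ^ 2 /
      (γ * polytropicPressure A γ ρ S) +
    ρ * ‖u‖ ^ 2 + (S - Sbar) ^ 2

/-- The **energy-flux multiplier** `e + 2 (p - p̄)`: the energy flux of the symmetrised system
relative to the rest state is `(e + 2 (p - p̄)) u` (`Vᵀ (ξ·A(U)) V = ⟪ξ, u⟫ (e + 2 (p - p̄))`).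
[folklore] -/
def energyFluxFactor (A γ ρbar Sbar ρ : ℝ) (u : E3) (S : ℝ) : ℝ :=
  energyDensity A γ ρbar Sbar ρ u S +
    2 * (polytropicPressure A γ ρ S - polytropicPressure A γ ρbar Sbar)

/-- Unfolding `energyDensity`. [folklore] -/
theorem energyDensity_def (A γ ρbar Sbar ρ : ℝ) (u : E3) (S : ℝ) :
    energyDensity A γ ρbar Sbar ρ u S =
      (polytropicPressure A γ ρ S - polytropicPressure A γ ρbar Sbar) ^ 2 /
          (γ * polytropicPressure A γ ρ S) +
        ρ * ‖u‖ ^ 2 + (S - Sbar) ^ 2 :=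
  rfl

/-- The energy density is nonnegative at states with `A, γ, ρ > 0`. [folklore] -/
theorem energyDensity_nonneg {A γ ρbar Sbar ρ : ℝ} (u : E3) (S : ℝ) (hA : 0 < A) (hγ : 0 < γ)
    (hρ : 0 < ρ) : 0 ≤ energyDensity A γ ρbar Sbar ρ u S := by
  unfold energyDensity
  have hp := polytropicPressure_pos (γ := γ) (S := S) hA hρ
  positivity

/-- The energy density vanishes at the rest state. [folklore] -/
theorem energyDensity_rest (A γ ρbar Sbar : ℝ) :
    energyDensity A γ ρbar Sbar ρbar 0 Sbar = 0 := by
  simp [energyDensity]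

/-- **The energy density vanishes only at the rest state**: for `A, γ, ρ, ρ̄ > 0`,
`e(ρ, u, S) = 0` forces `(ρ, u, S) = (ρ̄, 0, S̄)` (each of the three nonnegative terms vanishes;
`ρ ↦ A ρ^γ e^{S̄}` is injective on `ρ > 0`). [folklore] -/
theorem eq_of_energyDensity_eq_zero {A γ ρbar Sbar ρ : ℝ} {u : E3} {S : ℝ} (hA : 0 < A)
    (hγ : 0 < γ) (hρ : 0 < ρ) (hρbar : 0 < ρbar)
    (h : energyDensity A γ ρbar Sbar ρ u S = 0) : ρ = ρbar ∧ u = 0 ∧ S = Sbar := by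
  unfold energyDensity at h
  have hp := polytropicPressure_pos (γ := γ) (S := S) hA hρ
  have h1 : 0 ≤ (polytropicPressure A γ ρ S - polytropicPressure A γ ρbar Sbar) ^ 2 /
      (γ * polytropicPressure A γ ρ S) := by positivity
  have h2 : 0 ≤ ρ * ‖u‖ ^ 2 := by positivity
  have h3 : 0 ≤ (S - Sbar) ^ 2 := by positivity
  have hS : S = Sbar := by nlinarith
  have hu : u = 0 := by
    have : ρ * ‖u‖ ^ 2 = 0 := by linarith
    rcases mul_eq_zero.1 this with h' | h'
    · exact absurd h' hρ.ne'
    · exact norm_eq_zero.1 (pow_eq_zero_iff two_ne_zero |>.1 h')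
  have hpp : polytropicPressure A γ ρ S = polytropicPressure A γ ρbar Sbar := by
    have h0 : (polytropicPressure A γ ρ S - polytropicPressure A γ ρbar Sbar) ^ 2 /
        (γ * polytropicPressure A γ ρ S) = 0 := by linarith
    rcases div_eq_zero_iff.1 h0 with h' | h'
    · exact sub_eq_zero.1 (pow_eq_zero_iff two_ne_zero |>.1 h')
    · exact absurd h' (mul_pos hγ hp).ne'
  refine ⟨?_, hu, hS⟩
  subst hS
  unfold polytropicPressure at hpp
  have hγ' : ρ ^ γ = ρbar ^ γ := by
    have hE : 0 < Real.exp S := Real.exp_pos S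
    field_simp at hpp
    nlinarith [mul_pos hA hE]
  have := Real.rpow_left_injOn hγ.ne' (mem_setOf.2 hρ.le) (mem_setOf.2 hρbar.le) hγ'
  simpa using this

/-! ### Flux domination on cones of speed `σ' ≥ ‖u‖ + c` -/

/-- The acoustic part of the energy dominates the cross term of the flux:
`2 |p - p̄| ‖u‖ ≤ c ((p - p̄)²/(γ p) + ρ ‖u‖²)` with `c² = γ p / ρ` (AM–GM:
`ρ c · LHS-defect = (|p - p̄| - ρ c ‖u‖)² ≥ 0`). [folklore] -/
theorem two_mul_abs_mul_le_soundSpeed_mul {A γ ρ S : ℝ} (hA : 0 < A) (hγ : 0 < γ) (hρ : 0 < ρ)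
    (q w : ℝ) :
    2 * |q| * w ≤
      soundSpeed A γ ρ S * (q ^ 2 / (γ * polytropicPressure A γ ρ S) + ρ * w ^ 2) := by
  set c := soundSpeed A γ ρ S with hc
  set p := polytropicPressure A γ ρ S with hp
  have hp0 : 0 < p := polytropicPressure_pos hA hρ
  have hc0 : 0 < c := soundSpeed_pos hA hγ hρ
  have hcsq : c ^ 2 = γ * p / ρ := soundSpeed_sq hA hγ hρ
  have hγp : γ * p = ρ * c ^ 2 := by rw [hcsq]; field_simp
  have key : c * (q ^ 2 / (γ * p) + ρ * w ^ 2) - 2 * |q| * w = (|q| - ρ * c * w) ^ 2 / (ρ * c) := by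
    rw [hγp]
    field_simp
    rw [sub_sq, sq_abs]
    ring
  have : 0 ≤ (|q| - ρ * c * w) ^ 2 / (ρ * c) := by positivity
  linarith

/-- **Flux domination (positivity of the boundary form on a cone of speed `σ'`).** If
`‖ξ‖ ≤ 1` and `‖u‖ + c(ρ, S) ≤ σ'`, then
`0 ≤ σ' e + ⟪ξ, u⟫ (e + 2 (p - p̄))` (the quadratic form `Vᵀ(σ' A⁰ + ξ·A) V ≥ 0` of the
symmetrised system, eigenvalues `σ' + ⟪ξ, u⟫`, `σ' + ⟪ξ, u⟫ ± c ‖ξ‖ ≥ 0`). This is the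
inequality that makes the lateral boundary term of the local energy identity on the backward
cone `‖x - x₀‖ ≤ r₀ - σ' t` nonpositive. [folklore] -/
theorem energyFlux_domination {A γ ρbar Sbar ρ S σ' : ℝ} {u ξ : E3} (hA : 0 < A) (hγ : 0 < γ)
    (hρ : 0 < ρ) (hξ : ‖ξ‖ ≤ 1) (hσ' : ‖u‖ + soundSpeed A γ ρ S ≤ σ') :
    0 ≤ σ' * energyDensity A γ ρbar Sbar ρ u S + ⟪ξ, u⟫ * energyFluxFactor A γ ρbar Sbar ρ u S := by
  set c := soundSpeed A γ ρ S with hc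
  set e := energyDensity A γ ρbar Sbar ρ u S with he
  set P' := polytropicPressure A γ ρ S - polytropicPressure A γ ρbar Sbar with hP'
  have hq : |⟪ξ, u⟫| ≤ ‖u‖ := by
    calc |⟪ξ, u⟫| ≤ ‖ξ‖ * ‖u‖ := abs_real_inner_le_norm ξ u
      _ ≤ 1 * ‖u‖ := by gcongr
      _ = ‖u‖ := one_mul _
  have he0 : 0 ≤ e := energyDensity_nonneg u S hA hγ hρ
  have hc0 : 0 ≤ c := soundSpeed_nonneg A γ ρ S
  -- the acoustic part dominates the cross term
  have hdom : 2 * |P'| * ‖u‖ ≤ c * e := by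
    have h1 := two_mul_abs_mul_le_soundSpeed_mul (S := S) hA hγ hρ P' ‖u‖
    have h2 : P' ^ 2 / (γ * polytropicPressure A γ ρ S) + ρ * ‖u‖ ^ 2 ≤ e := by
      rw [he, energyDensity_def]
      nlinarith [sq_nonneg (S - Sbar)]
    exact h1.trans (mul_le_mul_of_nonneg_left h2 hc0)
  -- `σ' + ⟪ξ, u⟫ ≥ c`
  have hsum : c ≤ σ' + ⟪ξ, u⟫ := by
    have := neg_abs_le ⟪ξ, u⟫
    linarith
  have hflux : energyFluxFactor A γ ρbar Sbar ρ u S = e + 2 * P' := rfl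
  rw [hflux]
  have hcross : -(2 * |P'| * ‖u‖) ≤ ⟪ξ, u⟫ * (2 * P') := by
    have h1 : |⟪ξ, u⟫ * (2 * P')| ≤ 2 * |P'| * ‖u‖ := by
      rw [abs_mul, abs_mul, abs_of_pos (two_pos : (0 : ℝ) < 2)]
      nlinarith [abs_nonneg P', abs_nonneg ⟪ξ, u⟫]
    linarith [neg_abs_le (⟪ξ, u⟫ * (2 * P'))]
  have hmain : c * e ≤ (σ' + ⟪ξ, u⟫) * e := mul_le_mul_of_nonneg_right hsum he0
  nlinarith

/-! ### The `C¹` ramp `ψ(s) = (min s 0)²` and the backward-cone weight -/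

/-- The `C¹` cut-off `ψ(s) = (min s 0)²`: `ψ(s) = s²` for `s ≤ 0`, `ψ(s) = 0` for `s ≥ 0`,
`ψ'(s) = 2 min s 0 ≤ 0`; the profile of the space–time weight of the local energy method
(any nonincreasing `C¹` profile vanishing on `[0, ∞)` and positive on `(-∞, 0)` would do). [folklore] -/
def rampSq (s : ℝ) : ℝ :=
  min s 0 ^ 2

/-- `ψ ≥ 0`. [folklore] -/
theorem rampSq_nonneg (s : ℝ) : 0 ≤ rampSq s :=
  sq_nonneg _

/-- `ψ(s) = 0` for `s ≥ 0`. [folklore] -/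
theorem rampSq_of_nonneg {s : ℝ} (h : 0 ≤ s) : rampSq s = 0 := by
  simp [rampSq, min_eq_right h]

/-- `ψ(s) = s²` for `s ≤ 0`. [folklore] -/
theorem rampSq_of_nonpos {s : ℝ} (h : s ≤ 0) : rampSq s = s ^ 2 := by
  simp [rampSq, min_eq_left h]

/-- `ψ(s) > 0` for `s < 0`. [folklore] -/
theorem rampSq_pos {s : ℝ} (h : s < 0) : 0 < rampSq s := by
  rw [rampSq_of_nonpos h.le, sq]
  exact mul_pos_of_neg_of_neg h h

/-- `ψ(s) ≤ s²`. [folklore] -/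
theorem rampSq_le_sq (s : ℝ) : rampSq s ≤ s ^ 2 := by
  rcases le_total s 0 with h | h
  · rw [rampSq_of_nonpos h]
  · rw [rampSq_of_nonneg h]
    positivity

/-- `ψ` is differentiable with `ψ'(s) = 2 min s 0` (the two one-sided parabolas glue `C¹` at
`0`). [folklore] -/
theorem hasDerivAt_rampSq (s : ℝ) : HasDerivAt rampSq (2 * min s 0) s := by
  rcases lt_trichotomy s 0 with h | h | h
  · have heq : rampSq =ᶠ[nhds s] fun r => r ^ 2 := by
      filter_upwards [Iio_mem_nhds h] with r hr using rampSq_of_nonpos (le_of_lt hr)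
    rw [heq.hasDerivAt_iff, min_eq_left h.le]
    simpa using hasDerivAt_pow 2 s
  · subst h
    rw [min_self, mul_zero, hasDerivAt_iff_isLittleO]
    simp only [rampSq_of_nonneg le_rfl, sub_zero, smul_zero]
    refine Asymptotics.isLittleO_iff.2 fun c hc => ?_
    filter_upwards [Metric.ball_mem_nhds (0 : ℝ) hc] with r hr
    rw [Metric.mem_ball, dist_zero_right, Real.norm_eq_abs] at hr
    rw [Real.norm_eq_abs, Real.norm_eq_abs, abs_of_nonneg (rampSq_nonneg r)]
    calc rampSq r ≤ r ^ 2 := rampSq_le_sq r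
      _ = |r| * |r| := by rw [← sq_abs]; ring
      _ ≤ c * |r| := by gcongr
  · have heq : rampSq =ᶠ[nhds s] fun _ => (0 : ℝ) := by
      filter_upwards [Ioi_mem_nhds h] with r hr using rampSq_of_nonneg (le_of_lt hr)
    rw [heq.hasDerivAt_iff, min_eq_right h.le, mul_zero]
    exact hasDerivAt_const s 0

/-- `ψ' = 2 min(·, 0)`. [folklore] -/
theorem deriv_rampSq (s : ℝ) : deriv rampSq s = 2 * min s 0 :=
  (hasDerivAt_rampSq s).deriv

/-- `ψ' ≤ 0`. [folklore] -/
theorem two_mul_min_zero_nonpos (s : ℝ) : 2 * min s 0 ≤ 0 := by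
  have := min_le_right s 0
  linarith

/-- `ψ` is `C¹`. [folklore] -/
theorem contDiff_rampSq : ContDiff ℝ 1 rampSq := by
  rw [contDiff_one_iff_deriv]
  refine ⟨fun s => (hasDerivAt_rampSq s).differentiableAt, ?_⟩
  have : deriv rampSq = fun s => 2 * min s 0 := funext deriv_rampSq
  rw [this]
  exact continuous_const.mul (continuous_id.min continuous_const)

/-- **The backward-cone weight** `w(t, x) = ψ(‖x - x₀‖² - (r₀ - σ' t)²)` of the local energy
method: for `0 < r₀ - σ' t` it is positive exactly on the open ball `‖x - x₀‖ < r₀ - σ' t`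
(the time-`t` slice of the backward cone of speed `σ'` over the ball `B(x₀, r₀)`), vanishes
outside it, and is jointly `C¹`; `∂ₜw = 2σ'(r₀ - σ' t) ψ'`, `∇w = 2 (x - x₀) ψ'` with `ψ' ≤ 0`
(Sideris 1984, Proposition; John, *PDE*, Ch. 5 §3). [folklore] -/
def coneWeight (x₀ : E3) (r₀ σ' t : ℝ) (x : E3) : ℝ :=
  rampSq (‖x - x₀‖ ^ 2 - (r₀ - σ' * t) ^ 2)

/-- `w ≥ 0`. [folklore] -/
theorem coneWeight_nonneg (x₀ : E3) (r₀ σ' t : ℝ) (x : E3) : 0 ≤ coneWeight x₀ r₀ σ' t x :=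
  rampSq_nonneg _

/-- `w(t, x) = 0` outside the ball of radius `r₀ - σ' t ≥ 0`. [folklore] -/
theorem coneWeight_eq_zero {x₀ : E3} {r₀ σ' t : ℝ} {x : E3} (ht : 0 ≤ r₀ - σ' * t)
    (hx : r₀ - σ' * t ≤ ‖x - x₀‖) : coneWeight x₀ r₀ σ' t x = 0 := by
  unfold coneWeight
  refine rampSq_of_nonneg ?_
  nlinarith [norm_nonneg (x - x₀)]

/-- `w(t, x) > 0` inside the ball of radius `r₀ - σ' t`. [folklore] -/
theorem coneWeight_pos {x₀ : E3} {r₀ σ' t : ℝ} {x : E3} (hx : ‖x - x₀‖ < r₀ - σ' * t) :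
    0 < coneWeight x₀ r₀ σ' t x := by
  unfold coneWeight
  refine rampSq_pos ?_
  nlinarith [norm_nonneg (x - x₀)]

/-- For `0 ≤ σ' t` and `0 ≤ r₀ - σ' t` the slice `w(t, ·)` is supported in the closed ball
`closedBall x₀ r₀`. [folklore] -/
theorem coneWeight_eq_zero_of_notMem {x₀ : E3} {r₀ σ' t : ℝ} {x : E3} (ht : 0 ≤ r₀ - σ' * t)
    (ht' : 0 ≤ σ' * t) (hx : x ∉ Metric.closedBall x₀ r₀) : coneWeight x₀ r₀ σ' t x = 0 := by
  rw [Metric.mem_closedBall, dist_eq_norm, not_le] at hx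
  exact coneWeight_eq_zero ht (by linarith)

/-- The weight is jointly `C¹` in `(t, x)`. [folklore] -/
theorem contDiff_uncurry_coneWeight (x₀ : E3) (r₀ σ' : ℝ) :
    ContDiff ℝ 1 (Function.uncurry (coneWeight x₀ r₀ σ')) := by
  have h1 : ContDiff ℝ 1 fun p : ℝ × E3 => ‖p.2 - x₀‖ ^ 2 - (r₀ - σ' * p.1) ^ 2 :=
    ((contDiff_snd.sub contDiff_const).norm_sq ℝ).sub
      ((contDiff_const.sub (contDiff_const.mul contDiff_fst)).pow 2)
  exact contDiff_rampSq.comp h1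

/-- Time derivative of the weight: `∂ₜw(t, x) = 2 min(q, 0) · 2σ'(r₀ - σ' t)`,
`q = ‖x - x₀‖² - (r₀ - σ' t)²`. [folklore] -/
theorem hasDerivAt_coneWeight_time (x₀ : E3) (r₀ σ' t : ℝ) (x : E3) :
    HasDerivAt (fun s => coneWeight x₀ r₀ σ' s x)
      (2 * min (‖x - x₀‖ ^ 2 - (r₀ - σ' * t) ^ 2) 0 * (2 * σ' * (r₀ - σ' * t))) t := by
  have h1 : HasDerivAt (fun s => r₀ - σ' * s) (-σ') t := by
    simpa using ((hasDerivAt_id t).const_mul σ').const_sub r₀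
  have hfun : (fun s => ‖x - x₀‖ ^ 2 - (r₀ - σ' * s) ^ 2) =
      fun s => ‖x - x₀‖ ^ 2 - (r₀ - σ' * s) * (r₀ - σ' * s) := by
    funext s; ring
  have hq : HasDerivAt (fun s => ‖x - x₀‖ ^ 2 - (r₀ - σ' * s) ^ 2) (2 * σ' * (r₀ - σ' * t)) t := by
    rw [hfun]
    refine ((h1.mul h1).const_sub (‖x - x₀‖ ^ 2)).congr_deriv ?_
    ring
  exact (hasDerivAt_rampSq _).comp t hq

/-- Space derivative of the weight: `D(w(t, ·))(x) h = 2 min(q, 0) · 2 ⟪x - x₀, h⟫`. [folklore] -/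
theorem hasFDerivAt_coneWeight_space (x₀ : E3) (r₀ σ' t : ℝ) (x : E3) :
    HasFDerivAt (coneWeight x₀ r₀ σ' t)
      ((4 * min (‖x - x₀‖ ^ 2 - (r₀ - σ' * t) ^ 2) 0) • innerSL ℝ (x - x₀)) x := by
  have h0 : HasFDerivAt (fun y : E3 => y - x₀) (ContinuousLinearMap.id ℝ E3) x :=
    (hasFDerivAt_id x).sub_const x₀
  have h2 := h0.norm_sq.sub_const ((r₀ - σ' * t) ^ 2)
  have h3 := (hasDerivAt_rampSq (‖x - x₀‖ ^ 2 - (r₀ - σ' * t) ^ 2)).comp_hasFDerivAt x h2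
  refine h3.congr_fderiv ?_
  rw [ContinuousLinearMap.comp_id, ← Nat.cast_smul_eq_nsmul ℝ, smul_smul]
  congr 1
  push_cast
  ring

/-! ### The weighted local energy and Sideris' averaged quantities -/

/-- **Weighted local energy on the backward cone**:
`E(t) = ∫ w(t, x) e(ρ, u, S)(t, x) dx` with the cone weight `w = coneWeight x₀ r₀ σ' t` and the
symmetrised energy density `e` relative to the rest state `(ρ̄, 0, S̄)` (Sideris 1984/1985,
local energy estimates). [folklore] -/
def coneEnergy (A γ ρbar Sbar : ℝ) (ρ : ℝ → E3 → ℝ) (u : ℝ → E3 → E3) (S : ℝ → E3 → ℝ)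
    (x₀ : E3) (r₀ σ' t : ℝ) : ℝ :=
  ∫ x, coneWeight x₀ r₀ σ' t x * energyDensity A γ ρbar Sbar (ρ t x) (u t x) (S t x)

/-- Sideris' **mass excess** `m(t) = ∫ (ρ(x, t) - ρ̄) dx` (1.4a). [cite: Sideris1985, (1.4a)] -/
def massExcess (ρbar : ℝ) (ρ : ℝ → E3 → ℝ) (t : ℝ) : ℝ :=
  ∫ x, (ρ t x - ρbar)

/-- Sideris' **entropy-weighted mass excess** `η(t) = ∫ (ρ e^{S/γ} - ρ̄ e^{S̄/γ}) dx` (1.4b). [cite: Sideris1985, (1.4b)] -/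
def entropyMassExcess (γ ρbar Sbar : ℝ) (ρ : ℝ → E3 → ℝ) (S : ℝ → E3 → ℝ) (t : ℝ) : ℝ :=
  ∫ x, (ρ t x * Real.exp (S t x / γ) - ρbar * Real.exp (Sbar / γ))

/-- Sideris' **radial momentum** `F(t) = ∫ x · ρu(x, t) dx` (1.4c). [cite: Sideris1985, (1.4c)] -/
def radialMomentum (ρ : ℝ → E3 → ℝ) (u : ℝ → E3 → E3) (t : ℝ) : ℝ :=
  ∫ x, ρ t x * ⟪x, u t x⟫

/-- On `ℝ³ = EuclideanSpace ℝ (Fin 3)`, `∑ᵢ xᵢ (u x)ᵢ = ⟪x, u x⟫`: the integrand of (1.5c) in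
`IsSiderisLargeData` is that of `radialMomentum`. [folklore] -/
theorem sum_mul_apply_eq_inner (x v : E3) : ∑ i, x i * v i = ⟪x, v⟫ := by
  simp [PiLp.inner_apply, mul_comm]

/-- `F(0)` in the form of hypothesis (1.5c): `∫ ρ₀ ∑ᵢ xᵢ u₀ᵢ = radialMomentum ρ u 0` when
`ρ 0 = ρ₀`, `u 0 = u₀`. [cite: Sideris1985, (1.4c), (1.5c)] -/
theorem radialMomentum_zero_eq {ρ : ℝ → E3 → ℝ} {u : ℝ → E3 → E3} {ρ₀ : E3 → ℝ} {u₀ : E3 → E3}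
    (hρ : ρ 0 = ρ₀) (hu : u 0 = u₀) :
    radialMomentum ρ u 0 = ∫ x, ρ₀ x * ∑ i, x i * u₀ x i := by
  simp_rw [radialMomentum, sum_mul_apply_eq_inner, hρ, hu]

/-! ### Sideris' Proposition (finite propagation speed), stated as a named fact -/

/-- **Sideris' Proposition (finite propagation speed of the front), global-in-time form.**
Let `(ρ, u, S)` be a `C¹` solution of the polytropic Euler system (1.1 a–d) on `[0, ∞) × ℝ³`
(`A > 0`, `γ > 1`, `ρ̄ > 0`) whose initial data equal the rest state `(ρ̄, 0, S̄)` for `‖x‖ ≥ R`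
((1.2), after the Galilean reduction `ū = 0`). Then, with `σ` the far-field sound speed (1.3),
`(ρ, u, S)(t, x) = (ρ̄, 0, S̄)` whenever `t ≥ 0` and `‖x‖ ≥ R + σ t` — "the maximum speed of
propagation of the front of a smooth disturbance is governed by the sound speed"; Sideris:
"a consequence of local energy estimates; see the proposition in [10]" (= Sideris 1984).
Printed for `C¹` solutions on `0 ≤ t ≤ T` *on the exterior region* `D(t) = {‖x‖ > R + σ t}`
(open), `R` the radius of the bounded set carrying the disturbance; stated here for solutions on
all of `[0, ∞) × ℝ³` (a specialisation: the case used by Theorem 1 as vendored in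
`ShockFormationBarrier`), for `R > 0`, and on the closed region `‖x‖ ≥ R + σ t`, which follows
from the open one by continuity. [cite: Sideris1985, §1 Proposition (p. 476)] -/
def FinitePropagationSpeed : Prop :=
  ∀ (A γ R ρbar Sbar : ℝ), 0 < A → 1 < γ → 0 < R → 0 < ρbar →
    ∀ (ρ : ℝ → E3 → ℝ) (u : ℝ → E3 → E3) (S : ℝ → E3 → ℝ),
      IsPolytropicC1Solution A γ (Ici 0) ρ u S →
        (∀ x, R ≤ ‖x‖ → ρ 0 x = ρbar ∧ u 0 x = 0 ∧ S 0 x = Sbar) →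
          ∀ t, 0 ≤ t → ∀ x, R + farFieldSoundSpeed A γ ρbar Sbar * t ≤ ‖x‖ →
            ρ t x = ρbar ∧ u t x = 0 ∧ S t x = Sbar

end Literature.Barriers.AtomisticToContinuum.PolytropicEuler

end
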